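import Mathlib

/-!
# Möbius rigidity of rank-5 charged rooms — the algebraic kit (cell pub-hsemireg · 18881 · embed g12)

Companion kernel file of the memo `MOEBIUS-RIGIDITY-embed-g12.md` (same directory).
HONESTY CLAUSE: nothing here is proved toward HC ∕ HC_CM ∕ HC_AV ∕ №4 ∕ 26512 ∕ 18881 ∕ H2, and nothing is a rung of
`stub_rung_pad4_seedAt`; this is EVIDENCE (pure linear algebra over `ℂ`), Mathlib-only, no `sorry`, no new axioms,
no `set_option` beyond a linter switch.

## What is certified

The memo proves (pen, §3) the MÖBIUS RIGIDITY THEOREM: an order-4 Weil-clean identity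
`Σ_{m<4} V_m ⊗_{f<4} |v_{mf}⟩⟨v_{mf}| − Σ_x w_x ⊗_f |v_{xf}⟩⟨v_{xf}| = μ|0⁴⟩⟨1⁴| + μ̄|1⁴⟩⟨0⁴|` with exactly four positive
terms and `μ ≠ 0` (the shape of `(D4)` in every rank-5 torsion-free one-apex two-term room, by the HUB LAW of embed g11)
is a TWISTED DIAGONAL configuration: there are `λ₁, λ₂, λ₃ ∈ ℂˣ` with `t(v_{jf}) = λ_f · t(v_{j0})` for every term `j` and
slot `f` (`t = v₁/v₀` the affine coordinate of `ℙ¹`, poles `t = 0, ∞`), all points of slot `f` on one circle, and the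
weights a circle measure with vanishing Fourier modes `0..3` (g9) — so the diagonal theory (g9 cocircularity ∕ octagon,
g11 square theorem) applies to EVERY cell shape.  The proof is a chain of range arguments whose algebraic links are the
following statements about vectors of `ℂ²` (written as pairs, `d2 a b = a₀b₁ − a₁b₀`), all certified here:

* `coeff_mul_eq_zero_of_two_products` (K4): if `α s₁⊗s₂ + β t₁⊗t₂` is a product vector `p₁⊗p₂` and `s₁ ∦ t₁`, `s₂ ∦ t₂`,
  then `αβ = 0` — a product vector in the span of two transverse product vectors is one of them.
* `coeff_mul_eq_zero_of_ghz` (K5): if `u₁⊗u₂⊗u₃ = α|000⟩ + β|111⟩` then `αβ = 0` (the GHZ vector is not a product) — the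
  link behind «two positive cells never share a polar ray» (memo §2, PL1).
* `coeffs_eq_zero_of_three_products` (K1): three product vectors `x_m⊗y_m` of `ℂ²⊗ℂ²` with the `x_m` pairwise non-parallel
  and the `y_m` pairwise non-parallel are linearly independent.
* `all_ne_zero_of_four_products` (K1′): hence a non-trivial linear relation among four such product vectors has ALL four
  coefficients non-zero.
* `crossRatio_eq_of_four_products` (K2): a linear relation `Σ_{m≤4} γ_m x_m⊗y_m = 0` with `γ₃ ≠ 0` forces the cross-ratio
  identity `[x₃x₂][y₃y₁][x₄x₁][y₄y₂] = [x₄x₂][y₄y₁][x₃x₁][y₃y₂]` (`[ab] = d2 a b`), i.e. the four points `[x_m]` and `[y_m]`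
  of `ℙ¹` are projectively equivalent (memo §3 Step 4: four coplanar points of the Segre quadric lie on the graph of a
  Möbius map).
* `d2_mul_eq_zero_of_symmetric`, `cubes_symmetric` (K3): a product vector `u₁⊗u₂⊗u₃` lying in the span of symmetric cubes
  `a_m⊗a_m⊗a_m` has `u₁ ∥ u₂` (memo §3 Steps 5–6: coherence of the slots and of the negative terms).
* `offdiag_eq_zero_of_fixes_poles` (K6): a `2×2` matrix fixing both poles of `ℙ¹` is diagonal, and
  `normSq_diag_apply` (K7): `‖diag(1,λ)v‖² = ‖v₀‖²(1 + |λ|²r²)` on the circle `|t| = r` — the transformed weights are a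
  COMMON multiple of the original ones (memo §3 Step 9).

Sources: cell memos HUB-LAW-embed-g11 (L3 with poles, rank-5 structure §4a, square theorem), OCTAGON-ONSET-THEOREM-embed-g9
(Theorems 1–3: cocircularity, confinement, octagon count — stated for real weights), TWO-TERM-BLOCK-LAW-embed-g10 (model);
classical: the range criterion for separable states (P. Horodecki 1997), Kruskal-type identifiability of sums of few product
vectors, cross-ratio ∕ `PGL₂(ℂ) ≅ SO⁺(1,3)` acting on the celestial sphere of `NS(E×E)_ℝ ≅ ℝ^{1,3}`.
-/

set_option linter.dupNamespace false

namespace Summit.HodgeConjecture.HodgeConjecture.Cruxes.BlochSeedDiscOne.MoebiusRigidity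

open Complex

/-! ## Part 1 — the bracket `d2` -/

/-- The `2 × 2` determinant (bracket) of two vectors of `ℂ²`; for `a ≠ 0`, `d2 a b = 0` iff `b` is parallel to `a`. -/
def d2 (a b : ℂ × ℂ) : ℂ := a.1 * b.2 - a.2 * b.1

theorem d2_self (a : ℂ × ℂ) : d2 a a = 0 := by unfold d2; ring

theorem d2_swap (a b : ℂ × ℂ) : d2 a b = -d2 b a := by unfold d2; ring

theorem d2_ne_zero_swap {a b : ℂ × ℂ} (h : d2 a b ≠ 0) : d2 b a ≠ 0 := by
  rw [d2_swap]; exact neg_ne_zero.mpr h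

/-- `d2 a b = 0` with `a ≠ 0` means `b` is a multiple of `a` (the rays `[a] = [b]` of `ℙ¹`, or `b = 0`). -/
theorem exists_smul_of_d2_eq_zero {a b : ℂ × ℂ} (ha : a ≠ 0) (h : d2 a b = 0) :
    ∃ c : ℂ, b = (c * a.1, c * a.2) := by
  unfold d2 at h
  by_cases h1 : a.1 = 0
  · have h2 : a.2 ≠ 0 := by
      intro h2; apply ha; ext <;> simp [h1, h2]
    have hb1 : b.1 = 0 := by
      have : a.2 * b.1 = 0 := by linear_combination -h + b.2 * h1
      rcases mul_eq_zero.mp this with h' | h'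
      · exact absurd h' h2
      · exact h'
    refine ⟨b.2 / a.2, ?_⟩
    ext
    · simp [hb1, h1]
    · field_simp
  · refine ⟨b.1 / a.1, ?_⟩
    ext
    · field_simp
    · field_simp
      linear_combination h

/-! ## Part 2 — K4 and K5: product vectors in the span of two product vectors -/

/-- K4. If `α·s₁⊗s₂ + β·t₁⊗t₂ = p₁⊗p₂` (entrywise on `ℂ²⊗ℂ²`) with `s₁ ∦ t₁` and `s₂ ∦ t₂`, then `αβ = 0`:
the only product vectors in the span of two slot-wise transverse product vectors are (multiples of) those two. -/
theorem coeff_mul_eq_zero_of_two_products {α β : ℂ} {s₁ s₂ t₁ t₂ p₁ p₂ : ℂ × ℂ}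
    (h00 : α * s₁.1 * s₂.1 + β * t₁.1 * t₂.1 = p₁.1 * p₂.1)
    (h01 : α * s₁.1 * s₂.2 + β * t₁.1 * t₂.2 = p₁.1 * p₂.2)
    (h10 : α * s₁.2 * s₂.1 + β * t₁.2 * t₂.1 = p₁.2 * p₂.1)
    (h11 : α * s₁.2 * s₂.2 + β * t₁.2 * t₂.2 = p₁.2 * p₂.2)
    (hs : d2 s₁ t₁ ≠ 0) (ht : d2 s₂ t₂ ≠ 0) : α * β = 0 := by
  have key : α * β * (d2 s₁ t₁ * d2 s₂ t₂) = 0 := by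
    unfold d2
    linear_combination (α * s₁.2 * s₂.2 + β * t₁.2 * t₂.2) * h00 + (p₁.1 * p₂.1) * h11
      - (α * s₁.2 * s₂.1 + β * t₁.2 * t₂.1) * h01 - (p₁.1 * p₂.2) * h10
  rcases mul_eq_zero.mp key with h | h
  · exact h
  · exact absurd h (mul_ne_zero hs ht)

/-- K5 (GHZ). If the product vector `u₁⊗u₂⊗u₃ ∈ (ℂ²)^{⊗3}` equals `α|000⟩ + β|111⟩`, then `αβ = 0`.
(Only the `000`, `111` and `001` entries are needed.)  Used in the memo's PL1: two positive cells sharing a polar ray would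
force the other two cells' off-slot rays to span `⟨|000⟩, |111⟩⟩`, whose only product vectors are `|000⟩`, `|111⟩`. -/
theorem coeff_mul_eq_zero_of_ghz {α β : ℂ} {u₁ u₂ u₃ : ℂ × ℂ}
    (h000 : u₁.1 * u₂.1 * u₃.1 = α) (h111 : u₁.2 * u₂.2 * u₃.2 = β)
    (h001 : u₁.1 * u₂.1 * u₃.2 = 0) : α * β = 0 := by
  rw [← h000, ← h111]
  linear_combination (u₁.2 * u₂.2 * u₃.1) * h001

/-! ## Part 3 — K1, K1′: three slot-wise distinct product vectors are independent -/

/-- K1. Three product vectors `x_m⊗y_m ∈ ℂ²⊗ℂ²` (`m = 1,2,3`) with the `x_m` pairwise non-parallel and the `y_m` pairwise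
non-parallel are linearly independent: a relation `Σ α_m x_m⊗y_m = 0` (the four entries `h00..h11`) has `α₁ = α₂ = α₃ = 0`.
Proof: contract the second slot with the annihilator of one `y`, then the first slot with the annihilator of one `x`. -/
theorem coeffs_eq_zero_of_three_products {α₁ α₂ α₃ : ℂ} {x₁ x₂ x₃ y₁ y₂ y₃ : ℂ × ℂ}
    (h00 : α₁ * x₁.1 * y₁.1 + α₂ * x₂.1 * y₂.1 + α₃ * x₃.1 * y₃.1 = 0)
    (h01 : α₁ * x₁.1 * y₁.2 + α₂ * x₂.1 * y₂.2 + α₃ * x₃.1 * y₃.2 = 0)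
    (h10 : α₁ * x₁.2 * y₁.1 + α₂ * x₂.2 * y₂.1 + α₃ * x₃.2 * y₃.1 = 0)
    (h11 : α₁ * x₁.2 * y₁.2 + α₂ * x₂.2 * y₂.2 + α₃ * x₃.2 * y₃.2 = 0)
    (hx13 : d2 x₁ x₃ ≠ 0) (hx23 : d2 x₂ x₃ ≠ 0)
    (hy12 : d2 y₁ y₂ ≠ 0) (hy13 : d2 y₁ y₃ ≠ 0) :
    α₁ = 0 ∧ α₂ = 0 ∧ α₃ = 0 := by
  -- α₃ : kill y₁, then x₂  (uses [y₁y₃] ≠ 0, [x₂x₃] ≠ 0)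
  have e3 : α₃ * (d2 y₁ y₃ * d2 x₂ x₃) = 0 := by
    unfold d2
    linear_combination (y₁.2 * x₂.2) * h00 - (y₁.1 * x₂.2) * h01 - (y₁.2 * x₂.1) * h10
      + (y₁.1 * x₂.1) * h11
  -- α₂ : kill y₁, then x₃  (uses [y₁y₂] ≠ 0, [x₂x₃] ≠ 0)
  have e2 : α₂ * (d2 y₁ y₂ * d2 x₂ x₃) = 0 := by
    unfold d2
    linear_combination -(y₁.2 * x₃.2) * h00 + (y₁.1 * x₃.2) * h01 + (y₁.2 * x₃.1) * h10
      - (y₁.1 * x₃.1) * h11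
  -- α₁ : kill y₂, then x₃  (uses [y₁y₂] ≠ 0, [x₁x₃] ≠ 0)
  have e1 : α₁ * (d2 y₁ y₂ * d2 x₁ x₃) = 0 := by
    unfold d2
    linear_combination (y₂.2 * x₃.2) * h00 - (y₂.1 * x₃.2) * h01 - (y₂.2 * x₃.1) * h10
      + (y₂.1 * x₃.1) * h11
  refine ⟨?_, ?_, ?_⟩
  · rcases mul_eq_zero.mp e1 with h | h
    · exact h
    · exact absurd h (mul_ne_zero hy12 hx13)
  · rcases mul_eq_zero.mp e2 with h | h
    · exact h
    · exact absurd h (mul_ne_zero hy12 hx23)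
  · rcases mul_eq_zero.mp e3 with h | h
    · exact h
    · exact absurd h (mul_ne_zero hy13 hx23)

/-- K1′. A linear relation `Σ_{m≤4} γ_m x_m⊗y_m = 0` among four product vectors with the `x_m` pairwise non-parallel and the
`y_m` pairwise non-parallel is either trivial or has ALL coefficients non-zero. -/
theorem all_ne_zero_of_four_products {γ₁ γ₂ γ₃ γ₄ : ℂ} {x₁ x₂ x₃ x₄ y₁ y₂ y₃ y₄ : ℂ × ℂ}
    (h00 : γ₁ * x₁.1 * y₁.1 + γ₂ * x₂.1 * y₂.1 + γ₃ * x₃.1 * y₃.1 + γ₄ * x₄.1 * y₄.1 = 0)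
    (h01 : γ₁ * x₁.1 * y₁.2 + γ₂ * x₂.1 * y₂.2 + γ₃ * x₃.1 * y₃.2 + γ₄ * x₄.1 * y₄.2 = 0)
    (h10 : γ₁ * x₁.2 * y₁.1 + γ₂ * x₂.2 * y₂.1 + γ₃ * x₃.2 * y₃.1 + γ₄ * x₄.2 * y₄.1 = 0)
    (h11 : γ₁ * x₁.2 * y₁.2 + γ₂ * x₂.2 * y₂.2 + γ₃ * x₃.2 * y₃.2 + γ₄ * x₄.2 * y₄.2 = 0)
    (_hx12 : d2 x₁ x₂ ≠ 0) (hx13 : d2 x₁ x₃ ≠ 0) (hx14 : d2 x₁ x₄ ≠ 0)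
    (hx23 : d2 x₂ x₃ ≠ 0) (hx24 : d2 x₂ x₄ ≠ 0) (hx34 : d2 x₃ x₄ ≠ 0)
    (hy12 : d2 y₁ y₂ ≠ 0) (hy13 : d2 y₁ y₃ ≠ 0) (hy14 : d2 y₁ y₄ ≠ 0)
    (hy23 : d2 y₂ y₃ ≠ 0) (hy24 : d2 y₂ y₄ ≠ 0) (_hy34 : d2 y₃ y₄ ≠ 0)
    (hnt : ¬ (γ₁ = 0 ∧ γ₂ = 0 ∧ γ₃ = 0 ∧ γ₄ = 0)) :
    γ₁ ≠ 0 ∧ γ₂ ≠ 0 ∧ γ₃ ≠ 0 ∧ γ₄ ≠ 0 := by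
  refine ⟨?_, ?_, ?_, ?_⟩
  · intro h1
    -- relation among terms 2,3,4
    have := coeffs_eq_zero_of_three_products (α₁ := γ₂) (α₂ := γ₃) (α₃ := γ₄)
      (x₁ := x₂) (x₂ := x₃) (x₃ := x₄) (y₁ := y₂) (y₂ := y₃) (y₃ := y₄)
      (by linear_combination h00 - x₁.1 * y₁.1 * h1) (by linear_combination h01 - x₁.1 * y₁.2 * h1)
      (by linear_combination h10 - x₁.2 * y₁.1 * h1) (by linear_combination h11 - x₁.2 * y₁.2 * h1)
      hx24 hx34 hy23 hy24
    exact hnt ⟨h1, this.1, this.2.1, this.2.2⟩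
  · intro h2
    have := coeffs_eq_zero_of_three_products (α₁ := γ₁) (α₂ := γ₃) (α₃ := γ₄)
      (x₁ := x₁) (x₂ := x₃) (x₃ := x₄) (y₁ := y₁) (y₂ := y₃) (y₃ := y₄)
      (by linear_combination h00 - x₂.1 * y₂.1 * h2) (by linear_combination h01 - x₂.1 * y₂.2 * h2)
      (by linear_combination h10 - x₂.2 * y₂.1 * h2) (by linear_combination h11 - x₂.2 * y₂.2 * h2)
      hx14 hx34 hy13 hy14
    exact hnt ⟨this.1, h2, this.2.1, this.2.2⟩
  · intro h3
    have := coeffs_eq_zero_of_three_products (α₁ := γ₁) (α₂ := γ₂) (α₃ := γ₄)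
      (x₁ := x₁) (x₂ := x₂) (x₃ := x₄) (y₁ := y₁) (y₂ := y₂) (y₃ := y₄)
      (by linear_combination h00 - x₃.1 * y₃.1 * h3) (by linear_combination h01 - x₃.1 * y₃.2 * h3)
      (by linear_combination h10 - x₃.2 * y₃.1 * h3) (by linear_combination h11 - x₃.2 * y₃.2 * h3)
      hx14 hx24 hy12 hy14
    exact hnt ⟨this.1, this.2.1, h3, this.2.2⟩
  · intro h4
    have := coeffs_eq_zero_of_three_products (α₁ := γ₁) (α₂ := γ₂) (α₃ := γ₃)
      (x₁ := x₁) (x₂ := x₂) (x₃ := x₃) (y₁ := y₁) (y₂ := y₂) (y₃ := y₃)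
      (by linear_combination h00 - x₄.1 * y₄.1 * h4) (by linear_combination h01 - x₄.1 * y₄.2 * h4)
      (by linear_combination h10 - x₄.2 * y₄.1 * h4) (by linear_combination h11 - x₄.2 * y₄.2 * h4)
      hx13 hx23 hy12 hy13
    exact hnt ⟨this.1, this.2.1, this.2.2, h4⟩

/-! ## Part 4 — K2: a four-term relation forces equal cross-ratios (Möbius relatedness) -/

/-- K2. A linear relation `Σ_{m≤4} γ_m x_m⊗y_m = 0` with `γ₃ ≠ 0` forces the cross-ratio identity
`[x₃x₂][y₃y₁]·[x₄x₁][y₄y₂] = [x₄x₂][y₄y₁]·[x₃x₁][y₃y₂]`, i.e. (for slot-wise pairwise non-parallel points) the `4`-tuples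
`([x_m])` and `([y_m])` of `ℙ¹(ℂ)` have the same cross-ratio `[32][41]/([42][31])`, hence differ by a Möbius map.
Proof: kill `y₁` then `x₂` (resp. `y₂` then `x₁`) to get two linear equations `Aγ₃ + Bγ₄ = 0`, `Cγ₃ + Dγ₄ = 0`, whose
determinant `AD − BC` must vanish. -/
theorem crossRatio_eq_of_four_products {γ₁ γ₂ γ₃ γ₄ : ℂ} {x₁ x₂ x₃ x₄ y₁ y₂ y₃ y₄ : ℂ × ℂ}
    (h00 : γ₁ * x₁.1 * y₁.1 + γ₂ * x₂.1 * y₂.1 + γ₃ * x₃.1 * y₃.1 + γ₄ * x₄.1 * y₄.1 = 0)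
    (h01 : γ₁ * x₁.1 * y₁.2 + γ₂ * x₂.1 * y₂.2 + γ₃ * x₃.1 * y₃.2 + γ₄ * x₄.1 * y₄.2 = 0)
    (h10 : γ₁ * x₁.2 * y₁.1 + γ₂ * x₂.2 * y₂.1 + γ₃ * x₃.2 * y₃.1 + γ₄ * x₄.2 * y₄.1 = 0)
    (h11 : γ₁ * x₁.2 * y₁.2 + γ₂ * x₂.2 * y₂.2 + γ₃ * x₃.2 * y₃.2 + γ₄ * x₄.2 * y₄.2 = 0)
    (hγ : γ₃ ≠ 0) :
    d2 x₃ x₂ * d2 y₃ y₁ * (d2 x₄ x₁ * d2 y₄ y₂) = d2 x₄ x₂ * d2 y₄ y₁ * (d2 x₃ x₁ * d2 y₃ y₂) := by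
  -- kill y₁ (second slot), then x₂ (first slot)
  have eq1 : d2 x₃ x₂ * d2 y₃ y₁ * γ₃ + d2 x₄ x₂ * d2 y₄ y₁ * γ₄ = 0 := by
    unfold d2
    linear_combination (y₁.2 * x₂.2) * h00 - (y₁.1 * x₂.2) * h01 - (y₁.2 * x₂.1) * h10
      + (y₁.1 * x₂.1) * h11
  -- kill y₂, then x₁
  have eq2 : d2 x₃ x₁ * d2 y₃ y₂ * γ₃ + d2 x₄ x₁ * d2 y₄ y₂ * γ₄ = 0 := by
    unfold d2
    linear_combination (y₂.2 * x₁.2) * h00 - (y₂.1 * x₁.2) * h01 - (y₂.2 * x₁.1) * h10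
      + (y₂.1 * x₁.1) * h11
  have key : (d2 x₃ x₂ * d2 y₃ y₁ * (d2 x₄ x₁ * d2 y₄ y₂)
      - d2 x₄ x₂ * d2 y₄ y₁ * (d2 x₃ x₁ * d2 y₃ y₂)) * γ₃ = 0 := by
    linear_combination (d2 x₄ x₁ * d2 y₄ y₂) * eq1 - (d2 x₄ x₂ * d2 y₄ y₁) * eq2
  rcases mul_eq_zero.mp key with h | h
  · exact sub_eq_zero.mp h
  · exact absurd h hγ

/-! ## Part 5 — K3: product vectors among symmetric cubes have parallel factors -/

/-- Coordinate `b` of `p = (p₀, p₁) ∈ ℂ²` (`false ↦ p₀`, `true ↦ p₁`). -/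
def cB (p : ℂ × ℂ) (b : Bool) : ℂ := bif b then p.2 else p.1

@[simp] theorem cB_false (p : ℂ × ℂ) : cB p false = p.1 := rfl
@[simp] theorem cB_true (p : ℂ × ℂ) : cB p true = p.2 := rfl

/-- K3. If the product vector `u₁⊗u₂⊗u₃ ∈ (ℂ²)^{⊗3}` equals (entrywise) a tensor `R` symmetric in its first two slots, then
`[u₁u₂]·u₃ = 0`: either `u₃ = 0` or `u₁ ∥ u₂`.  (Apply with every pair of slots to get all three factors parallel.) -/
theorem d2_mul_eq_zero_of_symmetric {u₁ u₂ u₃ : ℂ × ℂ} (R : Bool → Bool → Bool → ℂ)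
    (hR : ∀ i j k, cB u₁ i * cB u₂ j * cB u₃ k = R i j k) (hsym : ∀ i j k, R i j k = R j i k) (k : Bool) :
    d2 u₁ u₂ * cB u₃ k = 0 := by
  have h1 := hR false true k
  have h2 := hR true false k
  have hs := hsym false true k
  simp only [cB_false, cB_true] at h1 h2
  unfold d2
  linear_combination h1 - h2 + hs

/-- The span of symmetric cubes: `R = Σ_m α_m a_m⊗a_m⊗a_m` is symmetric in its first two slots (indeed in all). -/
theorem cubes_symmetric {ι : Type*} [Fintype ι] (α : ι → ℂ) (a : ι → ℂ × ℂ) (i j k : Bool) :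
    (∑ m, α m * cB (a m) i * cB (a m) j * cB (a m) k) = ∑ m, α m * cB (a m) j * cB (a m) i * cB (a m) k := by
  apply Finset.sum_congr rfl
  intro m _
  ring

/-- K3, assembled: a product vector `u₁⊗u₂⊗u₃` with `u₃ ≠ 0` in the span of symmetric cubes has `u₁ ∥ u₂`
(and, permuting the slots, all three factors parallel — memo §3 Steps 5–6). -/
theorem d2_eq_zero_of_mem_span_cubes {ι : Type*} [Fintype ι] (α : ι → ℂ) (a : ι → ℂ × ℂ) {u₁ u₂ u₃ : ℂ × ℂ}
    (h : ∀ i j k, cB u₁ i * cB u₂ j * cB u₃ k = ∑ m, α m * cB (a m) i * cB (a m) j * cB (a m) k)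
    (hu₃ : u₃ ≠ 0) : d2 u₁ u₂ = 0 := by
  have hk : ∀ k, d2 u₁ u₂ * cB u₃ k = 0 := fun k =>
    d2_mul_eq_zero_of_symmetric (fun i j k => ∑ m, α m * cB (a m) i * cB (a m) j * cB (a m) k) h
      (fun i j k => cubes_symmetric α a i j k) k
  by_contra hne
  apply hu₃
  have h0 := hk false
  have h1 := hk true
  simp only [cB_false, cB_true] at h0 h1
  ext
  · simpa [hne] using h0
  · simpa [hne] using h1

/-! ## Part 6 — K6, K7: polar-axis Möbius maps -/

/-- K6. A `2×2` matrix `M = [[a, b], [c, d]]` mapping `e₀ = (1,0)` to a multiple of `e₀` and `e₁ = (0,1)` to a multiple of `e₁`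
(i.e. a Möbius map fixing both poles `t = 0, ∞` of `ℙ¹`) is diagonal: `b = c = 0`; as a Möbius map, `t ↦ (d/a)·t`. -/
theorem offdiag_eq_zero_of_fixes_poles {a b c d : ℂ}
    (h₀ : d2 (1, 0) (a * 1 + b * 0, c * 1 + d * 0) = 0) (h₁ : d2 (0, 1) (a * 0 + b * 1, c * 0 + d * 1) = 0) :
    b = 0 ∧ c = 0 := by
  unfold d2 at h₀ h₁
  simp at h₀ h₁
  exact ⟨h₁, h₀⟩

/-- K7. The weight factor of a polar-axis Möbius map is constant on latitude circles: for `v = (v₀, v₁)` on the circle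
`|t| = r` (`‖v₁‖² = r²‖v₀‖²`), `‖diag(1,λ) v‖² = ‖v₀‖² · (1 + ‖λ‖² r²)` — it depends on the circle, not on the point.
Hence the Möbius-transformed weights of the memo (§3 Step 9) are ONE common positive multiple of the original weights. -/
theorem normSq_diag_apply (lam v₀ v₁ : ℂ) (r : ℝ) (hc : normSq v₁ = r ^ 2 * normSq v₀) :
    normSq v₀ + normSq (lam * v₁) = normSq v₀ * (1 + normSq lam * r ^ 2) := by
  rw [normSq_mul, hc]; ring

/-! ## Part 7 — sanity instances (the diagonal case and the record twist) -/

/-- Sanity for K2: Möbius-related quadruples DO satisfy the cross-ratio identity — here `y = M x` for the polar-axis map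
`M = diag(1, λ)` (the twists of the memo), for arbitrary points. -/
theorem crossRatio_of_diag_twist (lam : ℂ) (x₁ x₂ x₃ x₄ : ℂ × ℂ) :
    let y : ℂ × ℂ → ℂ × ℂ := fun x => (x.1, lam * x.2)
    d2 x₃ x₂ * d2 (y x₃) (y x₁) * (d2 x₄ x₁ * d2 (y x₄) (y x₂))
      = d2 x₄ x₂ * d2 (y x₄) (y x₁) * (d2 x₃ x₁ * d2 (y x₃) (y x₂)) := by
  simp only [d2]
  ring

/-- Sanity for K2 in the other direction: for the four points `0, 1, 2, 3` (as `(1,t)`) and the NON-projective relabelling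
`0, 1, 2, 4` the identity fails (`[32][41]/([42][31])` is `(1·3)/(2·2) = 3/4` vs `(1·4)/(3·2) = 2/3`), so K2 has content. -/
theorem crossRatio_fails_example :
    d2 ((1:ℂ), 2) (1, 1) * d2 ((1:ℂ), 2) (1, 0) * (d2 ((1:ℂ), 3) (1, 0) * d2 ((1:ℂ), 4) (1, 1))
      ≠ d2 ((1:ℂ), 3) (1, 1) * d2 ((1:ℂ), 4) (1, 0) * (d2 ((1:ℂ), 2) (1, 0) * d2 ((1:ℂ), 2) (1, 1)) := by
  simp only [d2]
  norm_num

end Summit.HodgeConjecture.HodgeConjecture.Cruxes.BlochSeedDiscOne.MoebiusRigidity
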